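import Summits.ValiantsHypothesis.ValiantsHypothesis.Theorems.BarrierLeverNPCorpusChain
import Literature.Computability.AlgebraicComplexity.ValiantConjectureEquivProofs
import Literature.Barriers.ValiantsHypothesis.CKRST20NaturalProofsExist

/-!
# Route BarrierLever — item `NaturalProofsSeparateVNP` (stmt-ValiantsHypothesis-18972): its exact
# logical status, kernel-checked (cell valiant-natproofs, seat val-np-p4; bears on ladder rung V4)

`S := Theses.BarrierLever.NaturalProofsSeparateVNP` ("for one definability exponent `b₁`, for every
size exponent `b`, infinitely often in `n`, a LEVEL-ONE natural proof against `SmallCircuits ℂ n b`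
is nonzero at some member of the `VNP`-succinct class `SmallDefinable ℂ n b₁`") is the NEGATIVE
horn of the cell's win–win.  This file does NOT close the item; it proves, unconditionally, where
the item sits:

* `valiantsHypothesis_of_escape` — if, for one `b₁`, the `VNP`-succinct class
  `SmallDefinable ℂ n b₁` escapes `SmallCircuits ℂ n b` for every `b` infinitely often in `n`, then
  `VP_ℂ ≠ VNP_ℂ` (the SUMMIT statement `ValiantsHypothesis`): a diagonal p-definable family
  (per `n`, a member escaping at the largest exponent `≤ n`, by `Nat.findGreatest` and choice) would
  be p-computable under `VP = VNP`, which the escape at the next exponent refutes.  Bürgisser 2000,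
  Def. 2.1–2.5 (p-families, `VP`, `VNP`).
* `valiantsHypothesis_of_naturalProofsSeparateVNP` — hence **item 18972 implies the summit**
  (a natural proof `D` vanishing on `coeff(SmallCircuits ℂ n b)` and nonzero at `coeff g`
  certifies `g ∉ SmallCircuits ℂ n b`).  So `S` is at least as hard as `VP ≠ VNP` itself, and in
  addition refutes the crux (`NPCorpusChain.not_crux_of_naturalProofsSeparateVNP`, FSV Question 6).
* `krstForVP_of_not_naturalProofsSeparateVNP` — **`¬ S` implies item 18967 `KRSTForVP`** ("KRST for
  `VP`": exponential hardness of the permanent ⇒ FSV Question 6; KRST 2022 §5 open problem 1,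
  Bürgisser 2024 §7.3 printed-open), via the tree's `WinWin.win_win`; and
  `naturalProofsSeparateVNP_or_krstForVP` — items 18972 and 18967 cannot both fail.
* `not_naturalProofsSeparateVNP_of_crux` — the crux (item 14610) refutes `S` outright; with
  `naturalProofsSeparateVNP_iff_not_crux` — under `PermanentExpHardWith ℂ c m₀`, `S ↔ ¬ crux`.

Net: `crux ⇒ ¬S ⇒ KRSTForVP` and `S ⇒ (VP ≠ VNP) ∧ ¬crux`; neither `S` nor `¬S` is provable from
anything in print — Chatterjee–Kumar–Ramya–Saptharishi–Tengse 2020 Thm. 1.1/1.3 give equations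
only for the `{-1,0,1}`-coefficient SLICES of `VP` and `VNP` (they vanish on `VNP ∩ {-1,0,1}` as
well and are nonzero on sparse members of `VP`), so they are not `IsNaturalProof … (SmallCircuits ℂ
n b) …` and cannot witness `S`.

WHAT THIS IS NOT: not a proof or refutation of item 18972; not evidence for `VP ≠ VNP`; every
hypothesis named here (`S`, the crux, `KRSTForVP`, hardness of the permanent) is open.

References: [ForbesShpilkaVolk2018] Def. 1, Thm. 4, Question 6; [KumarRamyaSaptharishiTengse2022]
§1.2, Thm. MainThm, §5; [ChatterjeeKumarRamyaSaptharishiTengse2020] Thm. 1.1, Thm. 1.3, §1.4;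
[Burgisser2000] Def. 2.1–2.5; [Burgisser2024Completeness] §7.3.
-/

-- layout Summits/ValiantsHypothesis/ValiantsHypothesis forces the duplicated namespace component
set_option linter.dupNamespace false

noncomputable section

namespace Summit.ValiantsHypothesis.ValiantsHypothesis.Theorems.BarrierLever.NaturalProofsSeparateVNP

open Literature.Barriers.ValiantsHypothesis Literature.Computability.AlgebraicComplexity MvPolynomial
open Summit.ValiantsHypothesis.ValiantsHypothesis.Theorems.BarrierLever.SuccinctHittingSetsForVP
open Summit.ValiantsHypothesis.ValiantsHypothesis.Theses

/-! ### The item in the tree's vocabulary -/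

/-- The item decl is, on the nose, `∃ b₁, WinWin.NaturalProofsSeparate b₁` (the inlined class is the
tree's `SmallDefinable ℂ n b₁`). [cite: KumarRamyaSaptharishiTengse2022, §1.2] -/
theorem naturalProofsSeparateVNP_iff_exists_separate :
    BarrierLever.NaturalProofsSeparateVNP ↔ ∃ b₁, WinWin.NaturalProofsSeparate b₁ :=
  Iff.rfl

/-- A natural proof against `SmallCircuits ℂ n b` that is nonzero at `coeff g` certifies
`g ∉ SmallCircuits ℂ n b`; so `WinWin.NaturalProofsSeparate b₁` makes the `VNP`-succinct class
`SmallDefinable ℂ n b₁` ESCAPE every `SmallCircuits ℂ n b` infinitely often (FSV Def. 1: usefulness).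
[cite: ForbesShpilkaVolk2018, Def. 1] -/
theorem escape_of_separate {b₁ : ℕ} (h : WinWin.NaturalProofsSeparate b₁) (b n₀ : ℕ) :
    ∃ n : ℕ, n₀ ≤ n ∧ ∃ g ∈ SmallDefinable ℂ n b₁, g ∉ SmallCircuits ℂ n b := by
  obtain ⟨n, hn, D, ⟨-, -, hvan⟩, g, hg, hne⟩ := h b n₀
  exact ⟨n, hn, g, hg, fun hmem => hne (hvan g hmem)⟩

/-! ### Escape of the succinct classes implies the summit -/

/-- **Infinitely-often escape of `SmallDefinable ℂ · b₁` from every `SmallCircuits ℂ · b` implies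
`VP_ℂ ≠ VNP_ℂ`.**  Diagonalisation: were `VP = VNP`, choose for each `n` a member of
`SmallDefinable ℂ n b₁` whose complexity beats `n ^ c + c` for the LARGEST `c ≤ n` for which some
member does (`Nat.findGreatest`; the zero polynomial if none); this is a p-definable family in `n`
variables (Boolean sums of length `≤ n ^ b₁` of auxiliaries of size and degree `≤ n ^ b₁`, degree
`≤ n`), hence p-computable with some exponent `c`; but the escape at exponent `c + 1` beyond
`n ≥ c + 2` produces a member of complexity `> n ^ (c+1) ≥ n ^ c + c`, so the diagonal member at
that `n` beats `n ^ c + c` — contradiction. [cite: Burgisser2000, Def. 2.1–2.5] -/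
theorem valiantsHypothesis_of_escape {b₁ : ℕ}
    (h : ∀ b n₀ : ℕ, ∃ n : ℕ, n₀ ≤ n ∧ ∃ g ∈ SmallDefinable ℂ n b₁, g ∉ SmallCircuits ℂ n b) :
    _root_.ValiantsHypothesis := by
  classical
  unfold _root_.ValiantsHypothesis Literature.PNP.ValiantHypothesis
  intro hVeq
  -- p-boundedness from a bound `A * (n + 1) ^ B`
  have pb : ∀ (t : ℕ → ℕ) (A B : ℕ), (∀ n, t n ≤ A * (n + 1) ^ B) → IsPBounded t := fun t A B ht =>
    (IsPBounded.iff_exists_le_mul_succ_pow t).2 ⟨A, B, ht⟩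
  -- the escape, re-read as "some member beats `n ^ c + c`", for `n` as large as we like
  have hesc : ∀ c n₀ : ℕ, ∃ n : ℕ, n₀ ≤ n ∧ c ≤ n ∧ 1 ≤ n ∧
      ∃ g ∈ SmallDefinable ℂ n b₁, n ^ c + c < complexity g := by
    intro c n₀
    obtain ⟨n, hn, g, hg, hnot⟩ := h (c + 1) (max n₀ (c + 2))
    have hn₀ : n₀ ≤ n := (le_max_left _ _).trans hn
    have hc2 : c + 2 ≤ n := (le_max_right _ _).trans hn
    refine ⟨n, hn₀, by omega, by omega, g, hg, ?_⟩
    have hcx : ¬ complexity g ≤ n ^ (c + 1) := fun hle => hnot ⟨hg.1, hle⟩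
    have h2c : c + 1 ≤ n ^ c :=
      (Nat.succ_le_of_lt Nat.lt_two_pow_self).trans (Nat.pow_le_pow_left (by omega) c)
    have hstep : n ^ c + c < n ^ (c + 1) := by
      calc n ^ c + c < n ^ c + n ^ c := by omega
        _ = 2 * n ^ c := by ring
        _ ≤ n * n ^ c := Nat.mul_le_mul_right _ (by omega)
        _ = n ^ (c + 1) := by ring
    omega
  -- per `n`: a member that beats `n ^ c + c` for every `c ≤ n` for which some member does
  have key : ∀ n : ℕ, ∃ (u : ℕ) (G : MvPolynomial (Fin n ⊕ Fin u) ℂ), u ≤ n ^ b₁ ∧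
      complexity G ≤ n ^ b₁ ∧ G.totalDegree ≤ n ^ b₁ ∧ (boolSum G).totalDegree ≤ n ∧
      ∀ c : ℕ, c ≤ n → 1 ≤ n → (∃ g ∈ SmallDefinable ℂ n b₁, n ^ c + c < complexity g) →
        n ^ c + c < complexity (boolSum G) := by
    intro n
    by_cases hex : ∃ c, c ≤ n ∧ ∃ g ∈ SmallDefinable ℂ n b₁, n ^ c + c < complexity g
    · obtain ⟨c₀, hc₀, hP₀⟩ := hex
      obtain ⟨g, ⟨hdeg, u, hu, G, hGc, hGd, rfl⟩, hlt⟩ :=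
        Nat.findGreatest_spec (P := fun c => ∃ g ∈ SmallDefinable ℂ n b₁, n ^ c + c < complexity g)
          hc₀ hP₀
      refine ⟨u, G, hu, hGc, hGd, hdeg, fun c hc h1 hPc => lt_of_le_of_lt ?_ hlt⟩
      have hle : c ≤ Nat.findGreatest
          (fun c => ∃ g ∈ SmallDefinable ℂ n b₁, n ^ c + c < complexity g) n :=
        Nat.le_findGreatest hc hPc
      exact Nat.add_le_add (Nat.pow_le_pow_right h1 hle) hle
    · refine ⟨0, C 0, Nat.zero_le _, (complexity_C_holds (0 : ℂ)).trans_le (Nat.zero_le _),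
        by simp, by simp [boolSum], fun c hc _ hPc => absurd ⟨c, hc, hPc⟩ hex⟩
  choose u G hu hGc hGd hdeg hbest using key
  -- the diagonal family is p-definable …
  let F : PolyFamily ℂ := ⟨fun n => n, fun n => boolSum (G n)⟩
  have hFVNP : F ∈ VNP ℂ := by
    show IsVNPFamily F.poly
    refine ⟨⟨pb _ 1 1 fun n => ?_, pb _ 1 1 fun n => ?_⟩, u, G,
      ⟨⟨pb _ 2 (b₁ + 1) fun n => ?_, pb _ 1 b₁ fun n => ?_⟩, pb _ 1 b₁ fun n => ?_⟩, fun n => rfl⟩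
    · simp [F]
    · simpa [F] using (hdeg n).trans (Nat.le_succ n)
    · rw [Fintype.card_sum, Fintype.card_fin, Fintype.card_fin, two_mul]
      refine Nat.add_le_add ?_ ((hu n).trans ?_)
      · calc n ≤ n + 1 := Nat.le_succ n
          _ ≤ (n + 1) ^ (b₁ + 1) := Nat.le_self_pow (by omega) _
      · exact (Nat.pow_le_pow_left (Nat.le_succ n) b₁).trans
          (Nat.pow_le_pow_right (Nat.succ_pos n) (Nat.le_succ b₁))
    · rw [one_mul]; exact (hGd n).trans (Nat.pow_le_pow_left (Nat.le_succ n) b₁)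
    · rw [one_mul]; exact (hGc n).trans (Nat.pow_le_pow_left (Nat.le_succ n) b₁)
  -- … hence p-computable under `VP = VNP`, with some exponent `c`
  rw [← hVeq] at hFVNP
  obtain ⟨c, hc⟩ := (show IsVPFamily F.poly from hFVNP).2
  -- query the escape at exponent `c`
  obtain ⟨n, -, hcn, h1n, hPn⟩ := hesc c 0
  exact absurd (hc n) (not_le.mpr (hbest n c hcn h1n hPn))

/-- **Item 18972 implies the summit**: `NaturalProofsSeparateVNP → ValiantsHypothesis` (`VP_ℂ ≠
VNP_ℂ`).  Together with `NPCorpusChain.not_crux_of_naturalProofsSeparateVNP` (it also refutes FSV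
Question 6) this is why no fact in print — in particular not CKRST 2020 Thm. 1.1/1.3, whose equations
are slice-relative — can discharge the item. [cite: ForbesShpilkaVolk2018, Def. 1] -/
theorem valiantsHypothesis_of_naturalProofsSeparateVNP (h : BarrierLever.NaturalProofsSeparateVNP) :
    _root_.ValiantsHypothesis := by
  obtain ⟨b₁, hsep⟩ := h
  exact valiantsHypothesis_of_escape (b₁ := b₁) (escape_of_separate hsep)

/-- The same with both consequences bundled: item 18972 gives the summit AND the failure of the
crux (item 14610, FSV Question 6 over `ℂ`). [cite: ForbesShpilkaVolk2018, Question 6] -/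
theorem valiantsHypothesis_and_not_crux_of_naturalProofsSeparateVNP
    (h : BarrierLever.NaturalProofsSeparateVNP) :
    _root_.ValiantsHypothesis ∧ ¬ BarrierLever.SuccinctHittingSetsForVP :=
  ⟨valiantsHypothesis_of_naturalProofsSeparateVNP h, NPCorpusChain.not_crux_of_naturalProofsSeparateVNP h⟩

/-! ### The other side: `¬ S` is sandwiched between the crux and `KRSTForVP` -/

/-- **The crux refutes the item**: FSV Question 6 over `ℂ` (item 14610) gives
`¬ NaturalProofsSeparateVNP` (beyond the level-one succinctness exponent there is no level-one
natural proof at all). [cite: ForbesShpilkaVolk2018, Thm. 4 and Question 6] -/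
theorem not_naturalProofsSeparateVNP_of_crux (h : BarrierLever.SuccinctHittingSetsForVP) :
    ¬ BarrierLever.NaturalProofsSeparateVNP :=
  fun hS => NPCorpusChain.not_crux_of_naturalProofsSeparateVNP hS h

/-- **`¬` item 18972 implies item 18967 `KRSTForVP`** ("KRST for `VP`": exponential hardness of the
permanent ⇒ FSV Question 6): under the hardness hypothesis the tree's win–win (`WinWin.win_win`,
fed by the unconditional KRST theorem for `VNP`) leaves only the crux. [cite: KumarRamyaSaptharishiTengse2022, §1.2 and §5] -/
theorem krstForVP_of_not_naturalProofsSeparateVNP (h : ¬ BarrierLever.NaturalProofsSeparateVNP) :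
    BarrierLever.KRSTForVP := by
  rintro ⟨c, m₀, hper⟩
  rcases WinWin.win_win (c := c) (m₀ := m₀) hper with hQ | hsep
  · exact hQ
  · exact absurd hsep h

/-- **Dichotomy of the two open items, unconditionally**: item 18972 (`NaturalProofsSeparateVNP`)
or item 18967 (`KRSTForVP`) holds — they cannot both fail. [cite: KumarRamyaSaptharishiTengse2022, §1.2] -/
theorem naturalProofsSeparateVNP_or_krstForVP :
    BarrierLever.NaturalProofsSeparateVNP ∨ BarrierLever.KRSTForVP := by
  by_cases h : BarrierLever.NaturalProofsSeparateVNP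
  · exact Or.inl h
  · exact Or.inr (krstForVP_of_not_naturalProofsSeparateVNP h)

/-- Conversely, `KRSTForVP` together with exponential hardness of the permanent refutes the item
(through the crux). [cite: KumarRamyaSaptharishiTengse2022, §5] -/
theorem not_naturalProofsSeparateVNP_of_krstForVP {c m₀ : ℕ} (hper : PermanentExpHardWith ℂ c m₀)
    (hK : BarrierLever.KRSTForVP) : ¬ BarrierLever.NaturalProofsSeparateVNP :=
  not_naturalProofsSeparateVNP_of_crux (hK ⟨c, m₀, hper⟩)

/-- **Under exponential hardness of the permanent the item is EXACTLY the negation of the crux**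
(`S ↔ ¬ SuccinctHittingSetsForVP`): the two directions are the tree's
`NPCorpusChain.not_crux_of_naturalProofsSeparateVNP` (unconditional) and
`NPCorpusChain.naturalProofsSeparateVNP_of_not_crux` (KRST's win–win). [cite: KumarRamyaSaptharishiTengse2022, §1.2 and Thm. MainThm] -/
theorem naturalProofsSeparateVNP_iff_not_crux {c m₀ : ℕ} (hper : PermanentExpHardWith ℂ c m₀) :
    BarrierLever.NaturalProofsSeparateVNP ↔ ¬ BarrierLever.SuccinctHittingSetsForVP :=
  ⟨NPCorpusChain.not_crux_of_naturalProofsSeparateVNP,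
    NPCorpusChain.naturalProofsSeparateVNP_of_not_crux hper⟩

/-- And under the same hypothesis `¬ S` is exactly `KRSTForVP` (whose own hardness antecedent is
then discharged). [cite: KumarRamyaSaptharishiTengse2022, §5] -/
theorem not_naturalProofsSeparateVNP_iff_krstForVP {c m₀ : ℕ} (hper : PermanentExpHardWith ℂ c m₀) :
    ¬ BarrierLever.NaturalProofsSeparateVNP ↔ BarrierLever.KRSTForVP :=
  ⟨krstForVP_of_not_naturalProofsSeparateVNP, not_naturalProofsSeparateVNP_of_krstForVP hper⟩

/-! ### Conversely: the summit gives the escape, already with definability exponent `b₁ = 1`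

So the summit `VP_ℂ ≠ VNP_ℂ` is EQUIVALENT to the infinitely-often escape of the `VNP`-succinct
class from every `VP`-succinct class in FSV's coefficient regime (`d = n`), and item 18972 is
precisely "this escape, CERTIFIED by level-one natural proofs" (the escape itself is also recorded,
from the item, as `exists_smallDefinable_not_mem_smallCircuits` in the sibling file
`BarrierLeverNaturalProofsSeparateVNPLinks.lean` of the val-lit cell, which carries the item's
links to the crux and to `KRSTForVP`; the summit link is this file's). -/

/-- A family whose complexity is not p-bounded beats `n ^ k + k` beyond any threshold `n₁`
(the finitely many `n < n₁` have bounded complexity). [cite: Burgisser2000, Def. 2.1–2.2] -/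
theorem exists_ge_lt_complexity_of_not_isPBounded {F : PolyFamily ℂ}
    (h : ¬ IsPBounded fun n => complexity (F.poly n)) (k n₁ : ℕ) :
    ∃ n : ℕ, n₁ ≤ n ∧ n ^ k + k < complexity (F.poly n) := by
  classical
  by_contra hcon
  push Not at hcon
  apply h
  rw [IsPBounded.iff_exists_le_mul_succ_pow]
  refine ⟨k + 1 + ∑ i ∈ Finset.range n₁, complexity (F.poly i), k, fun n => ?_⟩
  have hpos : 1 ≤ (n + 1) ^ k := Nat.one_le_pow _ _ (Nat.succ_pos n)
  by_cases hn : n₁ ≤ n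
  · calc complexity (F.poly n) ≤ n ^ k + k := hcon n hn
      _ ≤ (n + 1) ^ k + k * (n + 1) ^ k :=
          Nat.add_le_add (Nat.pow_le_pow_left (Nat.le_succ n) k) (Nat.le_mul_of_pos_right k hpos)
      _ = (k + 1) * (n + 1) ^ k := by ring
      _ ≤ (k + 1 + ∑ i ∈ Finset.range n₁, complexity (F.poly i)) * (n + 1) ^ k :=
          Nat.mul_le_mul_right _ (Nat.le_add_right _ _)
  · have hle : complexity (F.poly n) ≤ ∑ i ∈ Finset.range n₁, complexity (F.poly i) :=
      Finset.single_le_sum (f := fun i => complexity (F.poly i)) (fun _ _ => Nat.zero_le _)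
        (Finset.mem_range.2 (Nat.lt_of_not_le hn))
    calc complexity (F.poly n) ≤ k + 1 + ∑ i ∈ Finset.range n₁, complexity (F.poly i) :=
          hle.trans (Nat.le_add_left _ _)
      _ ≤ (k + 1 + ∑ i ∈ Finset.range n₁, complexity (F.poly i)) * (n + 1) ^ k :=
          Nat.le_mul_of_pos_right _ hpos

/-- **The summit gives the escape with `b₁ = 1`.** From a family `F ∈ VNP ∖ VP` (Bürgisser 2000,
Def. 2.4–2.5): bound its number of variables, degree, Boolean-sum length and auxiliary size/degree
by one `m(n) = A (n+1)^B`; renaming `F_n` into `m(n)` variables (complexity preserved along the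
injection, `complexity_rename_of_injective`) places it in `SmallDefinable ℂ m(n) 1`, while
`L(F_n) > n ^ (b(B+1)) + _ ≥ m(n) ^ b` beyond any threshold keeps it outside
`SmallCircuits ℂ m(n) b`. [cite: Burgisser2000, Def. 2.1–2.5 and Rem. 2.2] -/
theorem escape_of_valiantsHypothesis (hV : _root_.ValiantsHypothesis) (b n₀ : ℕ) :
    ∃ n : ℕ, n₀ ≤ n ∧ ∃ f ∈ SmallDefinable ℂ n 1, f ∉ SmallCircuits ℂ n b := by
  classical
  unfold _root_.ValiantsHypothesis Literature.PNP.ValiantHypothesis at hV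
  -- a family in `VNP ∖ VP`
  obtain ⟨F, hFN, hFP⟩ : ∃ F : PolyFamily ℂ, F ∈ VNP ℂ ∧ F ∉ VP ℂ := by
    by_contra hcon
    push Not at hcon
    exact hV (Set.Subset.antisymm (VP_subset_VNP_holds ℂ) fun F hF => hcon F hF)
  obtain ⟨⟨hnv, hdegF⟩, u, g, ⟨⟨hcard, hdegg⟩, hcomp⟩, hsum⟩ := (show IsVNPFamily F.poly from hFN)
  have hnotP : ¬ IsPBounded fun n => complexity (F.poly n) := fun hP =>
    hFP (show IsVPFamily F.poly from ⟨⟨hnv, hdegF⟩, hP⟩)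
  -- one common bound `A (n+1)^B`, `A, B ≥ 1`
  obtain ⟨A, B, hA, hB, hT⟩ : ∃ A B : ℕ, 1 ≤ A ∧ 1 ≤ B ∧ ∀ n, F.nvars n ≤ A * (n + 1) ^ B ∧
      (F.poly n).totalDegree ≤ A * (n + 1) ^ B ∧ u n ≤ A * (n + 1) ^ B ∧
      (g n).totalDegree ≤ A * (n + 1) ^ B ∧ complexity (g n) ≤ A * (n + 1) ^ B := by
    obtain ⟨A₁, B₁, h₁⟩ := (IsPBounded.iff_exists_le_mul_succ_pow _).1 hnv
    obtain ⟨A₂, B₂, h₂⟩ := (IsPBounded.iff_exists_le_mul_succ_pow _).1 hdegF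
    obtain ⟨A₃, B₃, h₃⟩ := (IsPBounded.iff_exists_le_mul_succ_pow _).1 hcard
    obtain ⟨A₄, B₄, h₄⟩ := (IsPBounded.iff_exists_le_mul_succ_pow _).1 hdegg
    obtain ⟨A₅, B₅, h₅⟩ := (IsPBounded.iff_exists_le_mul_succ_pow _).1 hcomp
    have hmono : ∀ n A' B' : ℕ, A' ≤ A₁ + A₂ + A₃ + A₄ + A₅ + 1 → B' ≤ B₁ + B₂ + B₃ + B₄ + B₅ + 1 →
        A' * (n + 1) ^ B' ≤
          (A₁ + A₂ + A₃ + A₄ + A₅ + 1) * (n + 1) ^ (B₁ + B₂ + B₃ + B₄ + B₅ + 1) :=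
      fun n A' B' hA' hB' => Nat.mul_le_mul hA' (Nat.pow_le_pow_right (Nat.succ_pos n) hB')
    refine ⟨A₁ + A₂ + A₃ + A₄ + A₅ + 1, B₁ + B₂ + B₃ + B₄ + B₅ + 1, by omega, by omega,
      fun n => ⟨?_, ?_, ?_, ?_, ?_⟩⟩
    · have h := h₁ n
      simp only [Fintype.card_fin] at h
      exact h.trans (hmono n _ _ (by omega) (by omega))
    · exact (h₂ n).trans (hmono n _ _ (by omega) (by omega))
    · have h := h₃ n
      simp only [Fintype.card_sum, Fintype.card_fin] at h
      exact ((Nat.le_add_left _ _).trans h).trans (hmono n _ _ (by omega) (by omega))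
    · exact (h₄ n).trans (hmono n _ _ (by omega) (by omega))
    · exact (h₅ n).trans (hmono n _ _ (by omega) (by omega))
  -- a large `n` at which `F_n` beats `n ^ (b (B+1)) + _`
  obtain ⟨n, hn, hlt⟩ :=
    exists_ge_lt_complexity_of_not_isPBounded hnotP (b * (B + 1)) (n₀ + A * 2 ^ B + 1)
  obtain ⟨hnvars, hdegFn, hun, hdeggn, hcompn⟩ := hT n
  have h1n : 1 ≤ n := by omega
  have hAn : A * 2 ^ B ≤ n := by omega
  -- the number of variables `m = A (n+1)^B`
  have hm_ge : n + 1 ≤ A * (n + 1) ^ B := by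
    calc n + 1 = 1 * (n + 1) ^ 1 := by ring
      _ ≤ A * (n + 1) ^ B := Nat.mul_le_mul hA (Nat.pow_le_pow_right (Nat.succ_pos n) hB)
  have hm_le : A * (n + 1) ^ B ≤ n ^ (B + 1) := by
    calc A * (n + 1) ^ B ≤ A * (2 * n) ^ B :=
          Nat.mul_le_mul_left _ (Nat.pow_le_pow_left (by omega) B)
      _ = (A * 2 ^ B) * n ^ B := by rw [mul_pow]; ring
      _ ≤ n * n ^ B := Nat.mul_le_mul_right _ hAn
      _ = n ^ (B + 1) := by ring
  have hmb : (A * (n + 1) ^ B) ^ b ≤ n ^ (b * (B + 1)) := by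
    calc (A * (n + 1) ^ B) ^ b ≤ (n ^ (B + 1)) ^ b := Nat.pow_le_pow_left hm_le b
      _ = n ^ (b * (B + 1)) := by rw [← pow_mul, mul_comm]
  -- the renamed polynomial
  set ι : Fin (F.nvars n) → Fin (A * (n + 1) ^ B) := Fin.castLE (hnvars) with hι
  have hιinj : Function.Injective ι := Fin.castLE_injective _
  refine ⟨A * (n + 1) ^ B, by omega, rename ι (F.poly n),
    ⟨(totalDegree_rename_le _ _).trans hdegFn, u n, ?_,
      rename (Sum.map ι id) (g n), ?_, ?_, ?_⟩, ?_⟩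
  · rw [pow_one]; exact hun
  · rw [pow_one]; exact (complexity_rename_le_holds' _ _).trans hcompn
  · rw [pow_one]; exact (totalDegree_rename_le _ _).trans hdeggn
  · rw [boolSum_rename_sumMap, ← hsum n]
  · rintro ⟨-, hle⟩
    rw [complexity_rename_of_injective_holds hιinj] at hle
    exact absurd (hle.trans hmb) (not_le.mpr ((Nat.le_add_right _ _).trans_lt hlt))

/-- **The summit in FSV's coefficient regime.** `VP_ℂ ≠ VNP_ℂ` iff, for some definability
exponent `b₁`, the `VNP`-succinct class `SmallDefinable ℂ n b₁` escapes `SmallCircuits ℂ n b` for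
every `b`, infinitely often in `n`; and `b₁ = 1` already suffices
(`escape_of_valiantsHypothesis`). Item 18972 asserts this escape WITH a level-one natural-proof
certificate, which is what makes it refute the crux as well. [cite: Burgisser2000, Def. 2.4–2.5] -/
theorem valiantsHypothesis_iff_escape :
    _root_.ValiantsHypothesis ↔
      ∃ b₁ : ℕ, ∀ b n₀ : ℕ, ∃ n : ℕ, n₀ ≤ n ∧
        ∃ f ∈ SmallDefinable ℂ n b₁, f ∉ SmallCircuits ℂ n b :=
  ⟨fun hV => ⟨1, escape_of_valiantsHypothesis hV⟩, fun ⟨_, h⟩ => valiantsHypothesis_of_escape h⟩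

/-! ### The CKRST 2020 corpus and the item (after the val-lit typing `CKRST20NaturalProofsExist`)

Chatterjee–Kumar–Ramya–Saptharishi–Tengse 2020 PROVE equations only for the `{-1,0,1}`-coefficient
slices (`CKRST2020_thm_1_1` for `VP`, `CKRST2020_thm_1_3` for `VNP` — typed as facts over
`signCoeffSlice`, and refuting the slice-relative hypothesis `SuccinctHittingSetsForVPRel ℂ
signCoeffSlice`, `CKRST2020_thm_1_1.not_succinctHittingSetsForVPRel`); what would feed the item is
their OPEN Question 1.4 in the tree's frame, `CKRST2020_question4_frame` ("`VP` has `VP`-natural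
proofs": one level `a` and one family `D_n` that is, for every `b`, eventually a natural proof against
`SmallCircuits ℂ n b`) — typed as an open question, NOT a fact. The director's "hypothesis the item
needs, as `(h : …) →`" is therefore exactly: -/

/-- **CKRST Question 1.4 (frame) + exponential hardness of the permanent ⇒ item 18972.** An
affirmative answer to `CKRST2020_question4_frame` refutes the crux
(`question4_frame_not_succinctHittingSetsForVP`), and under `PermanentExpHardWith ℂ c m₀` the failure
of the crux is the item (`NPCorpusChain.naturalProofsSeparateVNP_of_not_crux`, KRST's win–win). Both
hypotheses are OPEN; this is the honest `(h : …) →` form of the val-np-p4 docket, not a discharge.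
[cite: ChatterjeeKumarRamyaSaptharishiTengse2020, Question 1.4] [cite: KumarRamyaSaptharishiTengse2022, §1.2] -/
theorem naturalProofsSeparateVNP_of_question4_frame {c m₀ : ℕ} (hper : PermanentExpHardWith ℂ c m₀)
    (hQ : CKRST2020_question4_frame) : BarrierLever.NaturalProofsSeparateVNP :=
  NPCorpusChain.naturalProofsSeparateVNP_of_not_crux hper
    (question4_frame_not_succinctHittingSetsForVP hQ)

/-- Likewise an affirmative answer to CKRST Question 1.4 (frame) together with exponential
hardness of the permanent REFUTES item 18967 `KRSTForVP` (whose conclusion is the crux).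
[cite: ChatterjeeKumarRamyaSaptharishiTengse2020, Question 1.4] [cite: KumarRamyaSaptharishiTengse2022, §5] -/
theorem not_krstForVP_of_question4_frame {c m₀ : ℕ} (hper : PermanentExpHardWith ℂ c m₀)
    (hQ : CKRST2020_question4_frame) : ¬ BarrierLever.KRSTForVP :=
  fun hK => question4_frame_not_succinctHittingSetsForVP hQ (hK ⟨c, m₀, hper⟩)

/-- Unconditionally, CKRST Question 1.4 (frame) already yields the summit-or-nothing reading of the
win–win: it refutes the crux, so by `naturalProofsSeparateVNP_or_krstForVP` EITHER item 18972
holds (hence `VP ≠ VNP`, `valiantsHypothesis_of_naturalProofsSeparateVNP`) OR item 18967 holds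
with a hardness antecedent that must then be FALSE (the permanent is not exponentially hard).
Stated as: `CKRST2020_question4_frame → NaturalProofsSeparateVNP ∨ ∀ c m₀, ¬ PermanentExpHardWith ℂ c m₀`.
[cite: ChatterjeeKumarRamyaSaptharishiTengse2020, Question 1.4] -/
theorem naturalProofsSeparateVNP_or_not_hard_of_question4_frame (hQ : CKRST2020_question4_frame) :
    BarrierLever.NaturalProofsSeparateVNP ∨ ∀ c m₀ : ℕ, ¬ PermanentExpHardWith ℂ c m₀ := by
  by_cases h : ∃ c m₀ : ℕ, PermanentExpHardWith ℂ c m₀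
  · obtain ⟨c, m₀, hper⟩ := h
    exact Or.inl (naturalProofsSeparateVNP_of_question4_frame hper hQ)
  · push Not at h
    exact Or.inr h

end Summit.ValiantsHypothesis.ValiantsHypothesis.Theorems.BarrierLever.NaturalProofsSeparateVNP

end
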